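/-
Copyright (c) 2026 the pub-hodgecm-mathlib formalisation cell (harness21).  Prover seat hodgecm-mathlib-LH4-p08 (g8), req620 Track A «(D-RAM) FOUR-FRAME» squad, helper lane
on h413 = stmt-HodgeConjecture-24833 (count-neutral).  STAGE-1b, row (2) cone road (LH4-p07 (g9) 12:09:09Z recipe «+ OC twin ★ p860034», type U).  2026-09-04.
-/
import Summits.HodgeConjecture.HodgeConjecture.Theorems.F0P3cDyRamToricCensusSumUnrWeldScaled   -- ★ p860037 (this seat): `toricCensusSum_unr_weld_inv_mul{,_flip}`
import Summits.HodgeConjecture.HodgeConjecture.Theorems.F0P3cDyRamToricCensusSumCutReindex    -- ★ p859781 (LH4-p07 (g9)): `cutOrderCounts_eq_cutCensusSum_of_cells`, `sub_eq_sum_ite_sub`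
import Summits.HodgeConjecture.HodgeConjecture.Theorems.F0P3cDyRamOrderFiltrationRange       -- ★ (LH4 GAP lineage): `isOrd_pow_iff_le`
import HarnessLib

/-!
# Crux `H413`, line LH4 «(D-RAM) FOUR-FRAME» — STAGE-1b, row (2): (OC-weldΔ)-Unr «THE LEVEL-PIECE WELD IN ORDER-COUNT CURRENCY, TYPE U»
# `ε·(cutOC_h(μ₁) − cutOC_{h′}(μ₁)) = W_U(m₁, jλ₁, C)` — both parity lanes (the type-U twin of LH4-p07 (g9)'s ★ p860034)

Cell `hodgecm-mathlib` (D-0151), FLOOR 0, crux item H413 = `stmt-HodgeConjecture-24833`, route of record `HCCMUnconditional`; squad F0∕P3c∕LH4 (req618∕req620); helper lane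
`--supports stmt-HodgeConjecture-24833 --as helper` (count-neutral).  THEOREMS ONLY (no `def`, no instance, no notation, no `sorry`; default heartbeats).

THE OBJECT.  The bottom socket of the level-piece law receives the G-side in ORDER-COUNT currency (★ p859713 cutoff census ∘ (β′) weights): per literal,
`cutOC(μ₁) = Σ_{j ≤ jλ₁} #levelSet(j, 0) + Σ_{b ∈ Icc 1 R} Σ_{j ≤ jλ₁} [j + b ≤ C]·q^b·#levelSetDep(j, b; μ₁)` over the cells of the SCALED cone multiplier `μ₁ = t⁻¹(λ − u)`
(`ρ t = t`, `|t| = exp(−e)`), rows up to `μ₁`'s conductor `jλ₁ = jλ − e`, the diagonal cutoff `C`, and a depth bound `R` on the non-empty cells.  THIS FILE welds the two literals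
in that currency, in ★ p860037 `toricCensusSum_unr_weld_inv_mul`'s frame VERBATIM plus the two cell-depth letters `hRh`, `hRh′`:
* **`levelOrderCounts_unr_weld_cut`** (even lane: `jλ₁` even, `m₁ ≡ d` on ε = 1) ⊢ `ε·((cutOC_h : ℕ) − (cutOC_{h′} : ℕ))` = ★ p860037's even value (★ T5s-v5 at `(m₁, jλ₁)` minus
  the two cut top bands);
* **`levelOrderCounts_unr_weld_cut_flip`** (odd lane: `jλ₁` odd, `m₁ ≢ d` on ε = 1) ⊢ the same with ★ p860037's flipped value.
Proof: `μ₁`'s tokens and order filtration `μ₁ ∈ 𝒪_j ↔ j ≤ jλ₁` (★ `isOrd_pow_iff_le`), ★ p859781 `cutOrderCounts_eq_cutCensusSum_of_cells` on both literals, `push_cast`,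
★ `sub_eq_sum_ite_sub`, ★ p860037 — letter for letter LH4-p07 (g9)'s ★ p860034 recipe for RamK.
HONEST LABEL.  Count-neutral; one frame, no CM place, no law of a piece asserted (the identification `e = a′`, `C = m + jλ − b′` with ★ p859713's objects and the near-1 token
letters are the (LAW) file's); `HC_CM` is proved only modulo the 7 printed citations (2 remaining named inputs: hLiu418 = `stmt-HodgeConjecture-24832`, h413 =
`stmt-HodgeConjecture-24833`) until rung 0 closes.

## References
* [Kottwitz1986BaseChangeUnits] R. E. Kottwitz, *Base change for unit elements of Hecke algebras*, Compositio Math. 60 (1986): §1 pp. 240–241.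
* [Rogawski1990] J. D. Rogawski, *Automorphic Representations of Unitary Groups in Three Variables*, Ann. of Math. Stud. 123 (1990): §4.9 Prop. 4.9.1 (b) p. 55, Lemma 4.9.3 p. 56.
* [Flicker1998UnitaryFL] Y. Z. Flicker, *Elementary proof of the fundamental lemma for a unitary group*, Canad. J. Math. 50 (1998): Prop. 7 p. 84.
* [Jacobowitz1962] R. Jacobowitz, *Hermitian forms over local fields*, Amer. J. Math. 84 (1962): §4.
-/

set_option autoImplicit false

namespace Summit.HodgeConjecture.HodgeConjecture.Cruxes.H413.F0P3cDyRamLevelOrderCountsUnrWeldCut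

open WithZero IsLocalRing Finset
open scoped Valued Classical
open Summit.HodgeConjecture.HodgeConjecture.Cruxes.H413.F0P3cDyRamToricCensusDefs
open Summit.HodgeConjecture.HodgeConjecture.Cruxes.H413.F0P3cDyRamOrderFiltrationRange (isOrd_pow_iff_le)
open Summit.HodgeConjecture.HodgeConjecture.Cruxes.H413.F0P3cDyRamToricCensusSumCutReindex (cutOrderCounts_eq_cutCensusSum_of_cells sub_eq_sum_ite_sub)
open Summit.HodgeConjecture.HodgeConjecture.Cruxes.H413.F0P3cDyRamToricCensusSumUnrWeldScaled (toricCensusSum_unr_weld_inv_mul toricCensusSum_unr_weld_inv_mul_flip)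

variable {K : Type*} [Field K] [Valued K ℤᵐ⁰] {ρ Θ : K →+* K} {α ϖE : K} {d t q : ℕ}
variable {K' : Type*} [Field K'] [Valued K' ℤᵐ⁰] {σ' : K' →+* K'} {π' : K'}

/-! ## §1 Even lane -/

/-- **(OC-weldΔ)-Unr, EVEN LANE.**  ★ p860037 `toricCensusSum_unr_weld_inv_mul`'s frame and letters VERBATIM + the cell-depth letters `hRh`, `hRh′`: the two literals' CUT
ORDER COUNTS over the cells of `μ₁ = t⁻¹(λ − u)` differ, after the sign `ε`, by ★ p860037's even value (★ T5s-v5 at `(m₁, jλ₁)` minus the two cut top bands).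
[cite: Kottwitz1986BaseChangeUnits, §1 pp. 240–241] [cite: Rogawski1990, §4.9 Prop. 4.9.1 (b) p. 55, Lemma 4.9.3 p. 56] [cite: Flicker1998UnitaryFL, Prop. 7 p. 84] -/
theorem levelOrderCounts_unr_weld_cut [IsDiscreteValuationRing 𝒪[K]] [Finite 𝓀[K]] [IsDiscreteValuationRing 𝒪[K']] [Finite 𝓀[K']] [IsAdicComplete 𝓂[K'] 𝒪[K']]
    (hρρ : ∀ x, ρ (ρ x) = x) (hvρ : ∀ x, Valued.v (ρ x) = Valued.v x) (hΘΘ : ∀ x, Θ (Θ x) = x) (hΘρ : ∀ x, Θ (ρ x) = ρ (Θ x))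
    (hvΘ : ∀ x, Valued.v (Θ x) = Valued.v x) (hα1 : Valued.v α ≤ 1) (hα : Valued.v (α - ρ α) = 1)
    (hρϖE : ρ ϖE = ϖE) (hϖE : Valued.v ϖE = exp (-1 : ℤ)) (hq : Nat.card 𝓀[K] = q ^ 2) (h2 : Valued.v (2 : K) = Valued.v ϖE ^ t)
    (hσ' : ∀ x, σ' (σ' x) = x) (hvσ' : ∀ x, Valued.v (σ' x) = Valued.v x) (hfix' : ∀ x : K', σ' x = x → x ≠ 0 → ∃ n : ℤ, Valued.v x = exp (2 * n))
    (hπ' : Valued.v π' = exp (-1 : ℤ)) (hdd' : Valued.v (π' - σ' π') = Valued.v π' ^ d) (hd : 1 ≤ d) (hq' : Nat.card 𝓀[K'] = q)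
    (jK : K' →+* K) (hjv : ∀ x, Valued.v (jK x) = Valued.v x) (hjΘ : ∀ x, Θ (jK x) = jK x)
    (hjfix : ∀ z : K, Θ z = z → ∃ x, jK x = z) (hjσ : ∀ x, jK (σ' x) = ρ (jK x))
    (hnorm : ∀ z : Kˣ, Θ (z : K) = z → Valued.v (z : K) = 1 → ∃ ω : Kˣ, Valued.v (ω : K) = 1 ∧ (ω : K) * Θ ω = z)
    {h h' : K} (hΘh : Θ h = h) (hh : h ≠ 0) (hhyper : ∃ x : K, x ≠ 0 ∧ h * Θ x * x + ρ (h * Θ x * x) = 0)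
    (hΘh' : Θ h' = h') (hh' : h' ≠ 0) (haniso : ¬ ∃ x : K, x ≠ 0 ∧ h' * Θ x * x + ρ (h' * Θ x * x) = 0)
    {lam u : K} (hlam : lam * Θ lam = 1) (hu : ρ u = u) (hu1 : u * Θ u = 1)
    {m jl : ℕ} (hm : Valued.v (lam - u) = exp (-(m : ℤ))) (hjl : Valued.v ((lam - u) - ρ (lam - u)) = exp (-(jl : ℤ)))
    {tc : K} (hρt : ρ tc = tc) {e : ℕ} (hte : Valued.v tc = exp (-(e : ℤ))) {m₁ jl₁ : ℕ} (hme : m₁ + e = m) (hjle : jl₁ + e = jl)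
    (hq2 : 2 ≤ q) (hd2 : 2 ≤ d) (hjl2 : jl₁ % 2 = 0) (hmS : d - d % 2 ≤ m₁ + 1) (ε : ℚ)
    (hreal : (ε = 1 ∧ m₁ % 2 = d % 2 ∧ 1 ≤ m₁ ∧ m₁ + d ≤ jl₁) ∨ (ε = -1 ∧ m₁ = jl₁ - d + 1 ∧ d ≤ jl₁))
    (C : ℕ) (hC : jl₁ ≤ C) (hCe : C + d ≤ m₁ + jl₁ + 1)
    {R R' : ℕ}
    (hRh : ∀ j b, 1 ≤ b → j ≤ jl₁ → (levelSetDep ρ Θ α ϖE h j b (tc⁻¹ * (lam - u))).Nonempty → b ≤ R)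
    (hRh' : ∀ j b, 1 ≤ b → j ≤ jl₁ → (levelSetDep ρ Θ α ϖE h' j b (tc⁻¹ * (lam - u))).Nonempty → b ≤ R') :
    ε * (((((∑ j ∈ range (jl₁ + 1), (levelSet ρ Θ α ϖE h j 0).ncard) +
            ∑ b ∈ Icc 1 R, ∑ j ∈ range (jl₁ + 1), (if j + b ≤ C then q ^ b * (levelSetDep ρ Θ α ϖE h j b (tc⁻¹ * (lam - u))).ncard else 0) : ℕ) : ℚ)) -
          ((((∑ j ∈ range (jl₁ + 1), (levelSet ρ Θ α ϖE h' j 0).ncard) +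
            ∑ b ∈ Icc 1 R', ∑ j ∈ range (jl₁ + 1), (if j + b ≤ C then q ^ b * (levelSetDep ρ Θ α ϖE h' j b (tc⁻¹ * (lam - u))).ncard else 0) : ℕ) : ℚ))) =
      (q : ℚ) ^ m₁ * ((1 + ((q : ℚ) + 1) * ∑ i ∈ range (jl₁ / 2), (q : ℚ) ^ i) - 2 * ∑ i ∈ range (d - d % 2), (q : ℚ) ^ i)
      - (if m₁ + d ≤ jl₁ ∧ (jl₁ - m₁ - d) % 2 = 0 then
          ((q : ℚ) + 1) * (q : ℚ) ^ (((C + m₁ - jl₁) / 2 + 1) + d + (jl₁ - m₁ - d) / 2 + m₁ / 2 - 1) *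
            ∑ i ∈ range (((2 * m₁ + 1 - d) / 2 + 1) - ((C + m₁ - jl₁) / 2 + 1)), (q : ℚ) ^ i
        else 0)
      - (if jl₁ + 1 = d + m₁ then
          ((q : ℚ) + 1) * (q : ℚ) ^ (((C + m₁ - jl₁) / 2 + 1) + d + m₁ - m₁ / 2 - 2) *
            ∑ i ∈ range (((2 * m₁ + 1 - d) / 2 + 1) - ((C + m₁ - jl₁) / 2 + 1)), (q : ℚ) ^ i
        else 0) := by
  classical
  have hϖE0 : ϖE ≠ 0 := fun h0 => by rw [h0, map_zero] at hϖE; exact (exp_ne_zero hϖE.symm).elim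
  have hϖE1 : Valued.v ϖE < 1 := by rw [hϖE, ← exp_zero, exp_lt_exp]; omega
  have hα' : ρ α ≠ α := fun h0 => by rw [h0, sub_self, map_zero] at hα; exact zero_ne_one hα
  have htc0 : tc ≠ 0 := fun h0 => by rw [h0, map_zero] at hte; exact (exp_ne_zero hte.symm).elim
  -- the scaled multiplier's tokens and its order filtration `μ₁ ∈ 𝒪_j ↔ j ≤ jl₁`
  have hm1 : Valued.v (tc⁻¹ * (lam - u)) = exp (-(m₁ : ℤ)) := by
    rw [map_mul, map_inv₀, hte, hm, ← exp_neg, ← exp_add]; congr 1; omega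
  have hjl1 : Valued.v (tc⁻¹ * (lam - u) - ρ (tc⁻¹ * (lam - u))) = exp (-(jl₁ : ℤ)) := by
    rw [map_mul ρ, map_inv₀, hρt, ← mul_sub, map_mul, map_inv₀, hte, hjl, ← exp_neg, ← exp_add]; congr 1; omega
  have hμle : Valued.v (tc⁻¹ * (lam - u)) ≤ 1 := by rw [hm1, ← exp_zero, exp_le_exp]; omega
  have hiff : ∀ j, IsOrd ρ α (ϖE ^ j) (tc⁻¹ * (lam - u)) ↔ j ≤ jl₁ := fun j =>
    isOrd_pow_iff_le hα' hϖE0 hϖE1 hμle (by rw [hjl1, hα, mul_one, hϖE, ← exp_nsmul, nsmul_eq_mul, mul_neg, mul_one]) j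
  -- ★ p859781: both literals re-indexed into the cut weld's row∕column shape
  rw [cutOrderCounts_eq_cutCensusSum_of_cells hρρ hvρ hΘΘ hΘρ hvΘ hα1 hα hρϖE hϖE hh hm1 hjl1 q hiff hC
      (fun j b hb hj hne => hRh j b hb ((hiff j).1 hj) hne),
    cutOrderCounts_eq_cutCensusSum_of_cells hρρ hvρ hΘΘ hΘρ hvΘ hα1 hα hρϖE hϖE hh' hm1 hjl1 q hiff hC
      (fun j b hb hj hne => hRh' j b hb ((hiff j).1 hj) hne)]
  have key := toricCensusSum_unr_weld_inv_mul hρρ hvρ hΘΘ hΘρ hvΘ hα1 hα hρϖE hϖE hq h2 hσ' hvσ' hfix' hπ' hdd' hd hq' jK hjv hjΘ hjfix hjσ hnorm hΘh hh hhyper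
    hΘh' hh' haniso hlam hu hu1 hm hjl hρt hte hme hjle hq2 hd2 hjl2 hmS ε hreal C hC hCe
  push_cast at key ⊢
  rw [sub_eq_sum_ite_sub]
  exact key


/-! ## §2 Odd lane -/

/-- **(OC-weldΔ)-Unr, ODD LANE.**  The same with `jλ₁` odd and the ε = 1 letter `m₁ ≢ d`; value ★ p860037's flipped value.
[cite: Kottwitz1986BaseChangeUnits, §1 pp. 240–241] [cite: Rogawski1990, §4.9 Prop. 4.9.1 (b) p. 55, Lemma 4.9.3 p. 56] [cite: Flicker1998UnitaryFL, Prop. 7 p. 84] -/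
theorem levelOrderCounts_unr_weld_cut_flip [IsDiscreteValuationRing 𝒪[K]] [Finite 𝓀[K]] [IsDiscreteValuationRing 𝒪[K']] [Finite 𝓀[K']] [IsAdicComplete 𝓂[K'] 𝒪[K']]
    (hρρ : ∀ x, ρ (ρ x) = x) (hvρ : ∀ x, Valued.v (ρ x) = Valued.v x) (hΘΘ : ∀ x, Θ (Θ x) = x) (hΘρ : ∀ x, Θ (ρ x) = ρ (Θ x))
    (hvΘ : ∀ x, Valued.v (Θ x) = Valued.v x) (hα1 : Valued.v α ≤ 1) (hα : Valued.v (α - ρ α) = 1)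
    (hρϖE : ρ ϖE = ϖE) (hϖE : Valued.v ϖE = exp (-1 : ℤ)) (hq : Nat.card 𝓀[K] = q ^ 2) (h2 : Valued.v (2 : K) = Valued.v ϖE ^ t)
    (hσ' : ∀ x, σ' (σ' x) = x) (hvσ' : ∀ x, Valued.v (σ' x) = Valued.v x) (hfix' : ∀ x : K', σ' x = x → x ≠ 0 → ∃ n : ℤ, Valued.v x = exp (2 * n))
    (hπ' : Valued.v π' = exp (-1 : ℤ)) (hdd' : Valued.v (π' - σ' π') = Valued.v π' ^ d) (hd : 1 ≤ d) (hq' : Nat.card 𝓀[K'] = q)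
    (jK : K' →+* K) (hjv : ∀ x, Valued.v (jK x) = Valued.v x) (hjΘ : ∀ x, Θ (jK x) = jK x)
    (hjfix : ∀ z : K, Θ z = z → ∃ x, jK x = z) (hjσ : ∀ x, jK (σ' x) = ρ (jK x))
    (hnorm : ∀ z : Kˣ, Θ (z : K) = z → Valued.v (z : K) = 1 → ∃ ω : Kˣ, Valued.v (ω : K) = 1 ∧ (ω : K) * Θ ω = z)
    {h h' : K} (hΘh : Θ h = h) (hh : h ≠ 0) (hhyper : ∃ x : K, x ≠ 0 ∧ h * Θ x * x + ρ (h * Θ x * x) = 0)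
    (hΘh' : Θ h' = h') (hh' : h' ≠ 0) (haniso : ¬ ∃ x : K, x ≠ 0 ∧ h' * Θ x * x + ρ (h' * Θ x * x) = 0)
    {lam u : K} (hlam : lam * Θ lam = 1) (hu : ρ u = u) (hu1 : u * Θ u = 1)
    {m jl : ℕ} (hm : Valued.v (lam - u) = exp (-(m : ℤ))) (hjl : Valued.v ((lam - u) - ρ (lam - u)) = exp (-(jl : ℤ)))
    {tc : K} (hρt : ρ tc = tc) {e : ℕ} (hte : Valued.v tc = exp (-(e : ℤ))) {m₁ jl₁ : ℕ} (hme : m₁ + e = m) (hjle : jl₁ + e = jl)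
    (hq2 : 2 ≤ q) (hd2 : 2 ≤ d) (hjl2 : jl₁ % 2 = 1) (hmS : d - d % 2 ≤ m₁ + 1) (ε : ℚ)
    (hreal : (ε = 1 ∧ m₁ % 2 ≠ d % 2 ∧ 1 ≤ m₁ ∧ m₁ + d ≤ jl₁) ∨ (ε = -1 ∧ m₁ = jl₁ - d + 1 ∧ d ≤ jl₁))
    (C : ℕ) (hC : jl₁ ≤ C) (hCe : C + d ≤ m₁ + jl₁ + 1)
    {R R' : ℕ}
    (hRh : ∀ j b, 1 ≤ b → j ≤ jl₁ → (levelSetDep ρ Θ α ϖE h j b (tc⁻¹ * (lam - u))).Nonempty → b ≤ R)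
    (hRh' : ∀ j b, 1 ≤ b → j ≤ jl₁ → (levelSetDep ρ Θ α ϖE h' j b (tc⁻¹ * (lam - u))).Nonempty → b ≤ R') :
    ε * (((((∑ j ∈ range (jl₁ + 1), (levelSet ρ Θ α ϖE h j 0).ncard) +
            ∑ b ∈ Icc 1 R, ∑ j ∈ range (jl₁ + 1), (if j + b ≤ C then q ^ b * (levelSetDep ρ Θ α ϖE h j b (tc⁻¹ * (lam - u))).ncard else 0) : ℕ) : ℚ)) -
          ((((∑ j ∈ range (jl₁ + 1), (levelSet ρ Θ α ϖE h' j 0).ncard) +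
            ∑ b ∈ Icc 1 R', ∑ j ∈ range (jl₁ + 1), (if j + b ≤ C then q ^ b * (levelSetDep ρ Θ α ϖE h' j b (tc⁻¹ * (lam - u))).ncard else 0) : ℕ) : ℚ))) =
      (q : ℚ) ^ m₁ * ((1 + ((q : ℚ) + 1) * ∑ i ∈ range (jl₁ / 2 + d % 2), (q : ℚ) ^ i) - 2 * ∑ i ∈ range (d - 1 + d % 2), (q : ℚ) ^ i)
      - (if m₁ + d ≤ jl₁ ∧ (jl₁ - m₁ - d) % 2 = 0 then
          ((q : ℚ) + 1) * (q : ℚ) ^ (((C + m₁ - jl₁) / 2 + 1) + d + (jl₁ - m₁ - d) / 2 + m₁ / 2 - 1) *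
            ∑ i ∈ range (((2 * m₁ + 1 - d) / 2 + 1) - ((C + m₁ - jl₁) / 2 + 1)), (q : ℚ) ^ i
        else 0)
      - (if jl₁ + 1 = d + m₁ then
          ((q : ℚ) + 1) * (q : ℚ) ^ (((C + m₁ - jl₁) / 2 + 1) + d + m₁ - m₁ / 2 - 2) *
            ∑ i ∈ range (((2 * m₁ + 1 - d) / 2 + 1) - ((C + m₁ - jl₁) / 2 + 1)), (q : ℚ) ^ i
        else 0) := by
  classical
  have hϖE0 : ϖE ≠ 0 := fun h0 => by rw [h0, map_zero] at hϖE; exact (exp_ne_zero hϖE.symm).elim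
  have hϖE1 : Valued.v ϖE < 1 := by rw [hϖE, ← exp_zero, exp_lt_exp]; omega
  have hα' : ρ α ≠ α := fun h0 => by rw [h0, sub_self, map_zero] at hα; exact zero_ne_one hα
  have htc0 : tc ≠ 0 := fun h0 => by rw [h0, map_zero] at hte; exact (exp_ne_zero hte.symm).elim
  -- the scaled multiplier's tokens and its order filtration `μ₁ ∈ 𝒪_j ↔ j ≤ jl₁`
  have hm1 : Valued.v (tc⁻¹ * (lam - u)) = exp (-(m₁ : ℤ)) := by
    rw [map_mul, map_inv₀, hte, hm, ← exp_neg, ← exp_add]; congr 1; omega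
  have hjl1 : Valued.v (tc⁻¹ * (lam - u) - ρ (tc⁻¹ * (lam - u))) = exp (-(jl₁ : ℤ)) := by
    rw [map_mul ρ, map_inv₀, hρt, ← mul_sub, map_mul, map_inv₀, hte, hjl, ← exp_neg, ← exp_add]; congr 1; omega
  have hμle : Valued.v (tc⁻¹ * (lam - u)) ≤ 1 := by rw [hm1, ← exp_zero, exp_le_exp]; omega
  have hiff : ∀ j, IsOrd ρ α (ϖE ^ j) (tc⁻¹ * (lam - u)) ↔ j ≤ jl₁ := fun j =>
    isOrd_pow_iff_le hα' hϖE0 hϖE1 hμle (by rw [hjl1, hα, mul_one, hϖE, ← exp_nsmul, nsmul_eq_mul, mul_neg, mul_one]) j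
  -- ★ p859781: both literals re-indexed into the cut weld's row∕column shape
  rw [cutOrderCounts_eq_cutCensusSum_of_cells hρρ hvρ hΘΘ hΘρ hvΘ hα1 hα hρϖE hϖE hh hm1 hjl1 q hiff hC
      (fun j b hb hj hne => hRh j b hb ((hiff j).1 hj) hne),
    cutOrderCounts_eq_cutCensusSum_of_cells hρρ hvρ hΘΘ hΘρ hvΘ hα1 hα hρϖE hϖE hh' hm1 hjl1 q hiff hC
      (fun j b hb hj hne => hRh' j b hb ((hiff j).1 hj) hne)]
  have key := toricCensusSum_unr_weld_inv_mul_flip hρρ hvρ hΘΘ hΘρ hvΘ hα1 hα hρϖE hϖE hq h2 hσ' hvσ' hfix' hπ' hdd' hd hq' jK hjv hjΘ hjfix hjσ hnorm hΘh hh hhyper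
    hΘh' hh' haniso hlam hu hu1 hm hjl hρt hte hme hjle hq2 hd2 hjl2 hmS ε hreal C hC hCe
  push_cast at key ⊢
  rw [sub_eq_sum_ite_sub]
  exact key

end Summit.HodgeConjecture.HodgeConjecture.Cruxes.H413.F0P3cDyRamLevelOrderCountsUnrWeldCut
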